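import Summits.BirchSwinnertonDyer.BirchSwinnertonDyer.Theorems.RamifiedSevenEllipticUnitsIndexIffLeaf
import Summits.BirchSwinnertonDyer.BirchSwinnertonDyer.Theorems.RamifiedSevenEllipticUnitsStrictControlSeven
import Summits.BirchSwinnertonDyer.Rank1Residual.X12.O11.RouteUSevenUnitCase
import Literature.NumberTheory.EllipticCurves.Wuthrich2014.ShaBoundProofs
import Literature.NumberTheory.EllipticCurves.AnalyticRankOrderProofs
import HarnessLib

set_option linter.dupNamespace false
set_option autoImplicit false

/-!
# Route `RamifiedSevenEllipticUnits` (rung K7r): after crux #4 — the crux `EllipticUnitIndexSeven`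
# (stmt-BirchSwinnertonDyer-19143) FOLLOWS FROM THE RUNG LEAF, unconditionally (`--supports 19143`)

Cell `bsd-cm`, seat `bsd-cm-k7r-c2` (gen 3). HONEST FRAMING: nothing here closes the crux or the
leaf; BSD is not proved by any of this. Crux #4 `StrictControlSeven` (stmt-19145) is now a THEOREM
of the tree (`StrictControlSeven_proof`, seat k7r-c4, p429067). Feeding it into gen 0's exact
decomposition (`…IndexIffLeaf`, p418077) gives, with NO hypothesis left:

* §1 `ellipticUnitIndexSeven_of_forall_bsdp_seven`: `BSD(W, 7)` for every globally minimal
  `W ∈ 𝒞₇` ⟹ the crux `(R-EU)@7` on 𝒞₇; `ellipticUnitIndexSeven_of_cmRamifiedSeven`: the rung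
  LEAF `X12.CMRamifiedSeven` ⟹ the crux. So crux #2 of route K7r is now formally NO STRONGER than
  the leaf it serves (it cannot fail while BSD₇ holds on 𝒞₇), and the registered skeleton of 19143
  (line `leaf-split`) has exactly ONE open stub, `stub_bsdpSevenOnClassCSeven` = the leaf read at
  `7` = the ramified-prime value formula (★_an) on the infinite class — open mathematics, not in
  print (K7R-EU-GAP v3). The iffs of p418077 with `h₃` discharged:
  `ellipticUnitIndexSeven_iff_cmRamifiedSeven_of_strictTorsion`,
  `ellipticUnitIndexSeven_iff_forall_bsdp_seven_of_strictTorsion` (hypotheses: crux #3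
  `StrictTorsionSeven` and the support item `PublishedFactsSeven` only).
* §2 MEMBER LEVEL: for a single `W ∈ 𝒞₇`, `(R-EU)@7` at `W` ⟸ `BSD(V, 7)` on the `ℚ`-isogeny
  class of `W` (`ellipticUnitIndexAt_seven_of_bsdp_isogenyClass`, fact-free), ⟸ `BSD(W, 7)` alone
  granted Cassels / modularity / GZK (`ellipticUnitIndexAt_seven_of_bsdp`, isogeny invariance by
  `Wuthrich2014.bsdp_of_isIsogenous`), ⟸ Route U's two per-curve inputs (U-D) `#Sel⁷(W/ℚ) ∣ 7` and
  (U-A) `ord₇ #Ш_an(W) = 0` (`ellipticUnitIndexAt_seven_of_routeU`); and the census member outside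
  the unit case, `305809c1 = 49a1^{(−79)}`: gen 2's `ellipticUnitIndexAt_c305809c1_of_strictControlAt`
  (p425603) with its `(R-ctrl)` hypothesis DISCHARGED (`ellipticUnitIndexAt_c305809c1`; binders: three
  named facts, `hr1`, hD [CERTIFIED-DATUM: exact 7-isogeny descent, two engines × two seats, kit
  j250795/j250884, rerun j251322/j251325; census26 j251392/j251393], hA [DATA]).

References: [Miller2011LMS] Def. 1.1; [Cassels1965ArithmeticVIII]; [Wuthrich2014] (isogeny
invariance of `BSD(E,p)` granted Cassels); [BurungaleKobayashiNakamuraOta2026] Thm. 1.7/1.8, §1.4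
(shape only, nothing used).
-/

noncomputable section

open scoped Classical

open WeierstrassCurve NumberField IsDedekindDomain
  Literature.NumberTheory.EllipticCurves
  Literature.NumberTheory.EllipticCurves.Rank1Residual
  Summit.BirchSwinnertonDyer.Rank1Residual.X12
  Summit.BirchSwinnertonDyer.Rank1Residual.X12.O11
  Summit.BirchSwinnertonDyer.Rank1Residual.X12.O11.RouteU
  Summit.BirchSwinnertonDyer.BirchSwinnertonDyer.Theses.RamifiedSevenEllipticUnits

namespace Summit.BirchSwinnertonDyer.BirchSwinnertonDyer.Theorems.RamifiedSevenEllipticUnits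

/-! ## §1 Class level: the leaf (at `7`) gives the crux, unconditionally -/

/-- **`BSD(E, 7)` for every globally minimal `E ∈ 𝒞₇` ⟹ `(R-EU)@7` on 𝒞₇** — gen 0's
`ellipticUnitIndexSeven_of_strictControlSeven_of_forall_bsdp_seven` with crux #4 supplied by the
tree's theorem `StrictControlSeven_proof` (k7r-c4, p429067). No hypothesis besides the leaf at `7`.
[cite: Miller2011LMS, Def. 1.1 (arXiv:1010.2431 p. 3)] -/
theorem ellipticUnitIndexSeven_of_forall_bsdp_seven
    (h7 : ∀ (W : WeierstrassCurve ℚ) [W.IsElliptic] [W.IsGloballyMinimal],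
      ClassCSeven W → BSDp W 7) :
    EllipticUnitIndexSeven :=
  ellipticUnitIndexSeven_of_strictControlSeven_of_forall_bsdp_seven StrictControlSeven_proof h7

/-- **The rung leaf K7r gives crux #2: `X12.CMRamifiedSeven → EllipticUnitIndexSeven`**,
unconditionally (crux #4 is a theorem). [cite: Miller2011LMS, Def. 1.1 (arXiv:1010.2431 p. 3)] -/
theorem ellipticUnitIndexSeven_of_cmRamifiedSeven
    (hleaf : Summit.BirchSwinnertonDyer.Rank1Residual.X12.CMRamifiedSeven) :
    EllipticUnitIndexSeven :=
  ellipticUnitIndexSeven_of_strictControlSeven_of_cmRamifiedSeven StrictControlSeven_proof hleaf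

/-- **`EllipticUnitIndexSeven ↔ X12.CMRamifiedSeven` given crux #3 `StrictTorsionSeven` and the
support item `PublishedFactsSeven`** (gen 0's iff with `h₃ := StrictControlSeven_proof`).
[cite: Miller2011LMS, Def. 1.1 (arXiv:1010.2431 p. 3)] -/
theorem ellipticUnitIndexSeven_iff_cmRamifiedSeven_of_strictTorsion (h₂ : StrictTorsionSeven)
    (h₅ : PublishedFactsSeven) :
    EllipticUnitIndexSeven ↔ Summit.BirchSwinnertonDyer.Rank1Residual.X12.CMRamifiedSeven :=
  ellipticUnitIndexSeven_iff_cmRamifiedSeven h₂ StrictControlSeven_proof h₅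

/-- **`EllipticUnitIndexSeven ↔ (BSD(E, 7) for every globally minimal `E ∈ 𝒞₇`)`** given
`StrictTorsionSeven` and `PublishedFactsSeven` (gen 0's iff with `h₃ := StrictControlSeven_proof`).
[cite: Miller2011LMS, Def. 1.1 (arXiv:1010.2431 p. 3)] -/
theorem ellipticUnitIndexSeven_iff_forall_bsdp_seven_of_strictTorsion (h₂ : StrictTorsionSeven)
    (h₅ : PublishedFactsSeven) :
    EllipticUnitIndexSeven ↔
      ∀ (W : WeierstrassCurve ℚ) [W.IsElliptic] [W.IsGloballyMinimal], ClassCSeven W → BSDp W 7 :=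
  ellipticUnitIndexSeven_iff_forall_bsdp_seven h₂ StrictControlSeven_proof h₅

/-! ## §2 Member level: `(R-EU)@7` at one `W ∈ 𝒞₇` from `BSD(W, 7)` -/

section Member

variable {W : WeierstrassCurve ℚ} [W.IsElliptic] [W.IsGloballyMinimal]

/-- **At a single member `W ∈ 𝒞₇`: `BSD(V, 7)` on the `ℚ`-isogeny class of `W` ⟹ `(R-EU)@7` at
`W`** — p409726's `ellipticUnitIndexAt_of_strictControlAt_of_bsdp_isogenyClass` with `(R-ctrl)@7`
at `W` supplied by `StrictControlSeven_proof`. Fact-free.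
[cite: Miller2011LMS, Def. 1.1 (arXiv:1010.2431 p. 3)] -/
theorem ellipticUnitIndexAt_seven_of_bsdp_isogenyClass [Fact (Nat.Prime 7)] (hC : ClassCSeven W)
    (h7 : ∀ (V : WeierstrassCurve ℚ) [V.IsElliptic] [V.IsGloballyMinimal],
      IsIsogenous W V → BSDp V 7) :
    RamifiedCMEllipticUnitIndexAt W 7 :=
  ellipticUnitIndexAt_of_strictControlAt_of_bsdp_isogenyClass (StrictControlSeven_proof W hC) h7

/-- **At a single member `W ∈ 𝒞₇`: `BSD(W, 7)` ⟹ `(R-EU)@7` at `W`**, granted Cassels' isogeny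
invariance of the BSD quotient (`hCassels`), modularity (`hmod`, for `L^{(r)}(E,1)/r! ≠ 0`) and GZK
(`hGZK`, for `Ш(W)` finite at analytic rank one): `BSD(·, 7)` is then an isogeny invariant
(`Wuthrich2014.bsdp_of_isIsogenous`). [cite: Cassels1965ArithmeticVIII]
[cite: Miller2011LMS, Def. 1.1 (arXiv:1010.2431 p. 3)] -/
theorem ellipticUnitIndexAt_seven_of_bsdp [Fact (Nat.Prime 7)] (hCassels : bsdRHS_eq_of_isIsogenous)
    (hmod : hasEntireLFunction_rat) (hGZK : rank_eq_analyticRank_of_analyticRank_le_one)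
    (hC : ClassCSeven W) (h7 : BSDp W 7) :
    RamifiedCMEllipticUnitIndexAt W 7 := by
  have hfin : Finite W.sha := (hGZK W (by rw [hC.2.2.1])).2
  have hlead : W.leadingLCoeff ≠ 0 := WeierstrassCurve.leadingLCoeff_ne_zero_holds (hmod W)
  exact ellipticUnitIndexAt_seven_of_bsdp_isogenyClass hC
    fun V _ _ hiso => Wuthrich2014.bsdp_of_isIsogenous hCassels hiso.symm_of_charZero hfin hlead h7

/-- **At a single member `W ∈ 𝒞₇`: Route U's per-curve inputs (U-D) `#Sel⁷(W/ℚ) ∣ 7` and (U-A)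
`ord₇ #Ш_an(W) = 0` ⟹ `(R-EU)@7` at `W`** (granted Cassels, modularity, GZK) — `RouteU.bsdp_seven`
then `ellipticUnitIndexAt_seven_of_bsdp`. [cite: Miller2011LMS, §1 and Def. 1.1]
[cite: Cassels1965ArithmeticVIII] -/
theorem ellipticUnitIndexAt_seven_of_routeU [Fact (Nat.Prime 7)]
    (hCassels : bsdRHS_eq_of_isIsogenous) (hmod : hasEntireLFunction_rat)
    (hGZK : rank_eq_analyticRank_of_analyticRank_le_one) (hC : ClassCSeven W)
    (hD : SelmerSevenBound W) (hA : ShaAnSevenUnit W) :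
    RamifiedCMEllipticUnitIndexAt W 7 :=
  ellipticUnitIndexAt_seven_of_bsdp hCassels hmod hGZK hC
    (RouteU.bsdp_seven W hGZK hC.1 hC.2.1 hC.2.2.1 hD hA)

end Member

end Summit.BirchSwinnertonDyer.BirchSwinnertonDyer.Theorems.RamifiedSevenEllipticUnits

end
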